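import Summits.ValiantsHypothesis.ValiantsHypothesis.Theorems.FeketeSOSHard.Negative.TameOperatorFalse

/-!
# `FeketeSOS.FeketeSOSHard` (stmt-ValiantsHypothesis-3996) — negative side, calibration: the cube witness is CHEAP
# once the support may be inflated (the `T̃` reshape is not hit)

Companion to `…Negative/TameOperatorFalse.lean` (seat val-width-3996-p5, g3), for the planners' reshape of stub 3′.  The rank-2
cube family (`#S = 4^J`, pattern `F = Π_{i<2J}(1 + X^{3^i} − X^{2·3^i})`, `M = 1`) forces mass `≥ 5^J = (#S)^{log₂√5}` on every
family of squares supported in the SAME `S` (`stub_tameOperator_false`).  With SUPPORT INFLATION — the relaxed operator stub `T̃` of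
`…PaleyRIPTradeoffInfl` (p584871), whose composition with the flat-RIP engine is in the tree — the same pattern is carried by TWO
squares, each supported on `≤ 2·3^J = 2·(#S)^{log₄ 3} ≤ 2·#S` points of `[0, 9^J)`, of total mass `≤ 4·3^J = 4·(#S)^{0.79…}`:
regroup `F = (Π_{i<J} q_i)·(Π_{J≤i<2J} q_i) = Y_J · Y_J(X^{3^J})` and use `P Q = ¼(P+Q)² − ¼(P−Q)²`.

* `support_expand_subset`, `card_support_expand_le`, `norm_coeff_expand_le` — bookkeeping for `expand`;
* `patY_add` — `Y (J+n) = Y J · expand_{3^J}(Y n)`;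
* `sqMass_le_card_mul` — `sqMass c g ≤ |c| · #supp g · B²` when `|g_n| ≤ B`;
* `rankTwo_cube_infl_cheap` — the calibration statement (floor on `S` AND the cheap inflated representation, same `F`).

So product/tensor witnesses separate `T` (same support; false) from `T̃` (inflated support; open, exponent `< 1` on this family).
Elementary; no facts, no definitions. [folklore]  Honest framing: calibration only; the crux, the engine and `VP ≠ VNP` untouched.
-/

-- `Summit.ValiantsHypothesis.ValiantsHypothesis.…` is the tree's namespace convention (summit = problem here).
set_option linter.dupNamespace false

namespace Summit.ValiantsHypothesis.ValiantsHypothesis.Theorems.FeketeSOSHard.Negative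

open Finset Polynomial
open scoped BigOperators
open Summit.ValiantsHypothesis.ValiantsHypothesis.Theorems.FeketeSOSHardPaleyRIP

noncomputable section

/-! ## `expand` bookkeeping -/

/-- The support of `expand p f` sits on `p · supp f`. [folklore] -/
theorem support_expand_subset (p : ℕ) (hp : 0 < p) (f : ℂ[X]) :
    (expand ℂ p f).support ⊆ f.support.image (· * p) := by
  intro n hn
  have h := mem_support_iff.1 hn
  rw [coeff_expand hp] at h
  split_ifs at h with hdvd
  · exact mem_image.2 ⟨n / p, mem_support_iff.2 h, Nat.div_mul_cancel hdvd⟩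
  · exact absurd rfl h

/-- `#supp (expand p f) ≤ #supp f`. [folklore] -/
theorem card_support_expand_le (p : ℕ) (hp : 0 < p) (f : ℂ[X]) :
    (expand ℂ p f).support.card ≤ f.support.card :=
  (card_le_card (support_expand_subset p hp f)).trans card_image_le

/-- Coefficient bounds survive `expand`. [folklore] -/
theorem norm_coeff_expand_le (p : ℕ) (hp : 0 < p) (f : ℂ[X]) (M : ℝ) (hM : 0 ≤ M)
    (hf : ∀ n, ‖f.coeff n‖ ≤ M) (n : ℕ) : ‖(expand ℂ p f).coeff n‖ ≤ M := by
  rw [coeff_expand hp]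
  split_ifs
  · exact hf _
  · rw [norm_zero]; exact hM

/-- Elements of the support of `expand p f` are `< p · N` when `supp f ⊂ [0, N)`. [folklore] -/
theorem mem_support_expand_lt (p : ℕ) (hp : 0 < p) (f : ℂ[X]) (N : ℕ) (hf : ∀ m, N ≤ m → f.coeff m = 0)
    (n : ℕ) (hn : n ∈ (expand ℂ p f).support) : n < p * N := by
  obtain ⟨k, hk, rfl⟩ := mem_image.1 (support_expand_subset p hp f hn)
  have hkN : k < N := by
    by_contra h
    exact (mem_support_iff.1 hk) (hf k (not_lt.1 h))
  rw [mul_comm]; exact Nat.mul_lt_mul_of_pos_left hkN hp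

/-! ## Regrouping the product pattern -/

/-- `Y (J + n) = Y J · expand_{3^J} (Y n)`: the last `n` blocks of the product are the first `n` blocks dilated by `3^J`.
[folklore] -/
theorem patY_add (Y : ℕ → ℂ[X]) (hY0 : Y 0 = 1)
    (hY : ∀ J, Y (J + 1) = Y J * (1 + X ^ 3 ^ J - X ^ (2 * 3 ^ J))) (J : ℕ) :
    ∀ n : ℕ, Y (J + n) = Y J * expand ℂ (3 ^ J) (Y n)
  | 0 => by rw [add_zero, hY0, map_one, mul_one]
  | n + 1 => by
    rw [← add_assoc, hY (J + n), patY_add Y hY0 hY J n, hY n, map_mul, map_sub, map_add, map_one, map_pow, map_pow,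
      expand_X, ← pow_mul, ← pow_mul, ← pow_add, show 3 ^ J * (2 * 3 ^ n) = 2 * 3 ^ (J + n) by rw [pow_add]; ring]
    ring

/-- `sqMass c g ≤ |c| · #supp g · B²` when every coefficient of `g` has modulus `≤ B`. [folklore] -/
theorem sqMass_le_card_mul (c : ℂ) (g : ℂ[X]) (B : ℝ) (hB : ∀ n, ‖g.coeff n‖ ≤ B) :
    sqMass c g ≤ ‖c‖ * g.support.card * B ^ 2 := by
  unfold sqMass
  rw [mul_assoc]
  refine mul_le_mul_of_nonneg_left ?_ (norm_nonneg c)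
  calc ∑ a ∈ g.support, ‖g.coeff a‖ ^ 2 ≤ ∑ a ∈ g.support, B ^ 2 :=
        sum_le_sum fun a _ => pow_le_pow_left₀ (norm_nonneg _) (hB a) 2
    _ = g.support.card * B ^ 2 := by rw [sum_const, nsmul_eq_mul]

/-! ## The calibration statement -/

/-- **The cube witness separates `T` from `T̃`.**  For every `J` there are a support `S` (`#S = 4^J`, `2a < 9^J` on `S`), two
weighted squares supported in `S` with pattern `F` (`deg F < 9^J`, coefficients of modulus `≤ 1`) such that
(i) every family of weighted squares supported in `S` with pattern `F` has mass `≥ 5^J = (#S)^{log₂ √5}` (same-support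
operator tameness fails with exponent `1.16…`), yet (ii) `F` is carried by TWO weighted squares each supported on at most
`2·3^J = 2·(#S)^{log₄ 3}` points of `[0, 9^J)` with total mass `≤ 4·3^J = 4·(#S)^{0.79…}` (inflated-support tameness holds
with exponent `< 1` on this family). [folklore] -/
theorem rankTwo_cube_infl_cheap (J : ℕ) :
    ∃ (S : Finset ℕ) (c : Fin 2 → ℂ) (w : Fin 2 → ℂ[X]) (F : ℂ[X]),
      S.card = 4 ^ J ∧ (∀ a ∈ S, 2 * a < 9 ^ J) ∧ (∀ i, (w i).support ⊆ S) ∧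
      (∑ i, C (c i) * w i ^ 2) = F ∧ F.natDegree < 9 ^ J ∧ (∀ n, ‖F.coeff n‖ ≤ 1) ∧
      (∀ (s' : ℕ) (c' : Fin s' → ℂ) (w' : Fin s' → ℂ[X]), (∀ j, (w' j).support ⊆ S) →
        (∑ j, C (c' j) * w' j ^ 2) = F → (5 : ℝ) ^ J ≤ ∑ j, sqMass (c' j) (w' j)) ∧
      ∃ (c'' : Fin 2 → ℂ) (w'' : Fin 2 → ℂ[X]), (∀ i, ((w'' i).support.card ≤ 2 * 3 ^ J)) ∧
        (∀ i, ∀ a ∈ (w'' i).support, a < 9 ^ J) ∧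
        (∑ i, C (c'' i) * w'' i ^ 2) = F ∧ ∑ i, sqMass (c'' i) (w'' i) ≤ 4 * 3 ^ J := by
  -- the objects, as anonymous recursions (as in `rankTwo_cube_mass_floor`)
  let ζ : ℕ → ℝ := fun e => if e = 0 then 2 else if e = 1 then 1 else if e = 2 then -2 else 0
  have hζ : ζ 0 = 2 ∧ ζ 1 = 1 ∧ ζ 2 = -2 ∧ ∀ e, 3 ≤ e → ζ e = 0 := by
    refine ⟨by simp [ζ], by simp [ζ], by simp [ζ], fun e he => ?_⟩
    simp only [ζ]
    rw [if_neg (by omega), if_neg (by omega), if_neg (by omega)]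
  let z : ℕ → ℕ → ℝ := fun J =>
    Nat.rec (motive := fun _ => ℕ → ℝ) (fun n => if n = 0 then 1 else 0)
      (fun J zJ n => ζ (n / 3 ^ J) * zJ (n % 3 ^ J)) J
  have hz0 : ∀ n, z 0 n = if n = 0 then 1 else 0 := fun n => rfl
  have hz : ∀ J n, z (J + 1) n = ζ (n / 3 ^ J) * z J (n % 3 ^ J) := fun J n => rfl
  let S : ℕ → Finset ℕ := fun J =>
    Nat.rec (motive := fun _ => Finset ℕ) {0} (fun J SJ => (range 2 ×ˢ SJ).image fun q => 3 ^ J * q.1 + q.2) J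
  have hS0 : S 0 = {0} := rfl
  have hS : ∀ J, S (J + 1) = (range 2 ×ˢ S J).image fun q => 3 ^ J * q.1 + q.2 := fun J => rfl
  let Y : ℕ → ℂ[X] := fun J =>
    Nat.rec (motive := fun _ => ℂ[X]) 1 (fun J YJ => YJ * (1 + X ^ 3 ^ J - X ^ (2 * 3 ^ J))) J
  have hY0 : Y 0 = 1 := rfl
  have hY : ∀ J, Y (J + 1) = Y J * (1 + X ^ 3 ^ J - X ^ (2 * 3 ^ J)) := fun J => rfl
  let a : ℂ := ((Real.goldenRatio : ℝ) : ℂ)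
  let b : ℂ := ((Real.goldenConj : ℝ) : ℂ)
  have hab : a * b = -1 := by
    simp only [a, b]; exact_mod_cast Real.goldenRatio_mul_goldenConj
  have hab' : a + b = 1 := by
    simp only [a, b]; exact_mod_cast Real.goldenRatio_add_goldenConj
  let U : ℕ → ℂ[X] := fun J => Nat.rec (motive := fun _ => ℂ[X]) 1 (fun J UJ => UJ * (C a - X ^ 3 ^ J)) J
  let V : ℕ → ℂ[X] := fun J => Nat.rec (motive := fun _ => ℂ[X]) 1 (fun J VJ => VJ * (X ^ 3 ^ J - C b)) J
  have hUV : U (2 * J) * V (2 * J) = Y (2 * J) :=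
    patU_mul_patV a b hab hab' Y U V hY0 hY rfl (fun _ => rfl) rfl (fun _ => rfl) (2 * J)
  have h9 : (3 : ℕ) ^ (2 * J) = 9 ^ J := by rw [pow_mul]; norm_num
  have h4 : (2 : ℕ) ^ (2 * J) = 4 ^ J := by rw [pow_mul]; norm_num
  have hN : 0 < 3 ^ J := pow_pos (by norm_num) J
  -- the inflated representation: `Y (2J) = Y J · expand (Y J)`
  set P : ℂ[X] := Y J with hP
  set Q : ℂ[X] := expand ℂ (3 ^ J) (Y J) with hQ
  have hPQ : P * Q = Y (2 * J) := by rw [two_mul, patY_add Y hY0 hY J J]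
  have hPcoef : ∀ n, ‖P.coeff n‖ ≤ 1 := norm_patY_coeff_le_one Y hY0 hY J
  have hQcoef : ∀ n, ‖Q.coeff n‖ ≤ 1 := norm_coeff_expand_le _ hN _ 1 zero_le_one hPcoef
  have hPsupp : P.support ⊆ range (3 ^ J) := fun n hn => by
    by_contra h
    exact (mem_support_iff.1 hn) (patY_coeff_eq_zero Y hY0 hY J n (not_lt.1 fun h' => h (mem_range.2 h')))
  have hPcard : P.support.card ≤ 3 ^ J := (card_le_card hPsupp).trans (card_range _).le
  have hQcard : Q.support.card ≤ 3 ^ J := (card_support_expand_le _ hN _).trans hPcard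
  have hPlt : ∀ n ∈ P.support, n < 9 ^ J := fun n hn =>
    lt_of_lt_of_le (mem_range.1 (hPsupp hn)) (by rw [← h9, two_mul, pow_add]; exact Nat.le_mul_of_pos_left _ hN)
  have hQlt : ∀ n ∈ Q.support, n < 9 ^ J := fun n hn => by
    have := mem_support_expand_lt _ hN (Y J) (3 ^ J) (patY_coeff_eq_zero Y hY0 hY J) n hn
    rw [← h9, two_mul, pow_add]; exact this
  set T : Finset ℕ := P.support ∪ Q.support with hT
  have hTcard : T.card ≤ 2 * 3 ^ J := (card_union_le _ _).trans (by omega)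
  have hTlt : ∀ n ∈ T, n < 9 ^ J := fun n hn => by
    rcases mem_union.1 hn with h | h
    · exact hPlt n h
    · exact hQlt n h
  have hwT := support_two_squares_subset P Q T subset_union_left subset_union_right
  refine ⟨S (2 * J), ![1 / 4, -1 / 4], ![U (2 * J) + V (2 * J), U (2 * J) - V (2 * J)], Y (2 * J),
    by rw [card_cube S hS0 hS, h4], fun s hs => by rw [← h9]; exact two_mul_lt_of_mem_cube S hS0 hS hs,
    support_two_squares_subset _ _ _ (patU_support S hS0 hS a U rfl (fun _ => rfl) (2 * J))
      (patV_support S hS0 hS b V rfl (fun _ => rfl) (2 * J)),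
    by rw [sum_two_squares_eq, hUV], by rw [← h9]; exact natDegree_patY_lt Y hY0 hY (2 * J),
    norm_patY_coeff_le_one Y hY0 hY (2 * J), fun s' c' w' hsupp heq => ?_,
    ![1 / 4, -1 / 4], ![P + Q, P - Q], fun i => (card_le_card (hwT i)).trans hTcard,
    fun i n hn => hTlt n (hwT i hn), by rw [sum_two_squares_eq, hPQ], ?_⟩
  · -- (i) the floor on the same support: `√5^{2J} = 5^J`
    have h := mass_floor S hS0 hS ζ z hζ hz0 hz Y hY0 hY (2 * J) s' c' w' hsupp heq
    rwa [pow_mul, Real.sq_sqrt (by norm_num : (0 : ℝ) ≤ 5)] at h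
  · -- (ii) the mass of the two inflated squares: each `≤ ¼ · (2·3^J) · 2²`
    have hadd : ∀ n, ‖(P + Q).coeff n‖ ≤ 2 := fun n => by
      rw [coeff_add]; exact (norm_add_le _ _).trans (by linarith [hPcoef n, hQcoef n])
    have hsub : ∀ n, ‖(P - Q).coeff n‖ ≤ 2 := fun n => by
      rw [coeff_sub]; exact (norm_sub_le _ _).trans (by linarith [hPcoef n, hQcoef n])
    have hcoef : ∀ i : Fin 2, ∀ n, ‖(((![P + Q, P - Q] : Fin 2 → ℂ[X]) i)).coeff n‖ ≤ 2 := by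
      intro i n
      fin_cases i
      · exact hadd n
      · exact hsub n
    have hc : ∀ i : Fin 2, ‖(![1 / 4, -1 / 4] : Fin 2 → ℂ) i‖ = 1 / 4 := by
      intro i; fin_cases i <;> simp
    have hone : ∀ i : Fin 2,
        sqMass ((![1 / 4, -1 / 4] : Fin 2 → ℂ) i) ((![P + Q, P - Q] : Fin 2 → ℂ[X]) i) ≤ 2 * 3 ^ J := by
      intro i
      refine (sqMass_le_card_mul _ _ 2 (hcoef i)).trans ?_
      rw [hc i]
      have : (((![P + Q, P - Q] : Fin 2 → ℂ[X]) i).support.card : ℝ) ≤ 2 * 3 ^ J := by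
        exact_mod_cast (card_le_card (hwT i)).trans hTcard
      nlinarith
    calc ∑ i, sqMass ((![1 / 4, -1 / 4] : Fin 2 → ℂ) i) ((![P + Q, P - Q] : Fin 2 → ℂ[X]) i)
        ≤ ∑ _i : Fin 2, (2 * 3 ^ J : ℝ) := sum_le_sum fun i _ => hone i
      _ = 4 * 3 ^ J := by rw [sum_const, card_univ, Fintype.card_fin, nsmul_eq_mul]; ring

end

end Summit.ValiantsHypothesis.ValiantsHypothesis.Theorems.FeketeSOSHard.Negative
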